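import Summits.CriticalPhenomena.PercolationContinuityZ3.Theorems.PercNearOneGluingNoHeavyLowerTailSahiCoveringTripleAllOrders
import Literature.Combinatorics.Sahi2008.Percolation
import Literature.Combinatorics.Sahi2008.PushForward
import Literature.Combinatorics.Sahi2008.FKG
import Mathlib.Tactic.FinCases
import HarnessLib

/-!
# `NoHeavyLowerTail` (crux stmt-CriticalPhenomena-4575), master-family line P2: three monotone events with `B ⊆ A ∪ C` under a
# product measure — Sahi positivity of EVERY order on their pattern algebra ⟺ the one cubic `E₃(A,B,C) ≥ 0`

Support file (seat `prim-masterthm-p2`, gen 2; `--supports stmt-CriticalPhenomena-4575`); no named fact, no sorry.  Companion of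
`…SahiCoveringTripleAllOrders.lean` (`P7.sahiPositive_iff_two_and_cubic`: on `P7 = {0,1}³ ∖ {010}` all orders ⟺
`SahiPositive 2 ∧` the row cubic).

* `P7.pat A B C : Ω → P7` — the PATTERN MAP `ω ↦ (1_A, 1_B, 1_C)(ω)` of three events with `B ⊆ A ∪ C`; monotone along
  implications (`pat_le_pat`), hence monotone for three up-sets and dually for three down-sets of a preorder; the coordinate
  up-sets `U_A, U_B, U_C` pull back to `A, B, C` (`setInd_U?_comp_pat`).
* TRANSFER to product measures on `Set ι` (Kahn's setting [Kahn2022, Conj. 5]; bond percolation is `ι = Sym2 V`): the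
  push-forward of `bernoulliWeight p` along `pat` is `SahiPositive 2` (Harris = `sahiPositive_two` of the FKG product weight,
  transported along the monotone pattern map by `SahiPositive.of_pushWeight`; for decreasing events via the order dual) and its
  cubic is `sahiE3 (prodBernoulli p) A B C` (`pat_cubic_eq`).  Hence **`sahiPositive_pat_iff_of_isLowerSet` /
  `…_of_isUpperSet`: `(∀ n, SahiPositive (pattern weight) n) ↔ 0 ≤ sahiE3 (prodBernoulli p) A B C`** for any three
  decreasing (resp. increasing) events with `B ⊆ A ∪ C`, and `sahiE_pattern_nonneg_of_isLowerSet / _of_isUpperSet`: ONE proved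
  cubic `E₃(A,B,C) ≥ 0` gives `E_n ≥ 0` for every `n` and every family of nonnegative pattern-measurable functions monotone in the
  same direction.  Instances (sequel `…SahiCoveringTripleRows.lean`): the hybrid/group three-point lower bound family and the
  nine five-terminal E3GRP rows.
-/

namespace Summit.CriticalPhenomena.PercolationContinuityZ3.Theorems.SahiDeltaSystem

open Finset Function Literature.Combinatorics.Sahi2008

namespace P7

/-! ## Part 2.  The pattern map of three events with `B ⊆ A ∪ C` -/

/-- The cell of `P7` with a given pattern of bits (`010`, which does not occur, is sent to `bot`). [this work] -/
def ofBits : Bool → Bool → Bool → P7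
  | true, true, true => top
  | true, true, false => pC
  | true, false, true => pB
  | true, false, false => hA
  | false, true, true => pA
  | false, false, true => hC
  | false, _, false => bot

/-- `ofBits` is monotone in the bits, on admissible patterns (kernel check). [this work] -/
theorem ofBits_mono : ∀ a b c a' b' c' : Bool, (b = true → a = true ∨ c = true) → (b' = true → a' = true ∨ c' = true) →
    (a = true → a' = true) → (b = true → b' = true) → (c = true → c' = true) → ofBits a b c ≤ ofBits a' b' c' := by
  decide

/-- Membership of `ofBits a b c` in `U_A` is the first bit (on admissible patterns). [this work] -/
theorem ofBits_mem_UA : ∀ a b c : Bool, (b = true → a = true ∨ c = true) → (ofBits a b c ∈ UA ↔ a = true) := by decide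
/-- Membership of `ofBits a b c` in `U_B` is the second bit (on admissible patterns). [this work] -/
theorem ofBits_mem_UB : ∀ a b c : Bool, (b = true → a = true ∨ c = true) → (ofBits a b c ∈ UB ↔ b = true) := by decide
/-- Membership of `ofBits a b c` in `U_C` is the third bit (on admissible patterns). [this work] -/
theorem ofBits_mem_UC : ∀ a b c : Bool, (b = true → a = true ∨ c = true) → (ofBits a b c ∈ UC ↔ c = true) := by decide

section Pattern

variable {Ω : Type*}

open Classical in
/-- The PATTERN MAP of three events: `ω ↦` the cell of `(1_A(ω), 1_B(ω), 1_C(ω))`. [this work] -/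
noncomputable def pat (A B C : Set Ω) (ω : Ω) : P7 := ofBits (decide (ω ∈ A)) (decide (ω ∈ B)) (decide (ω ∈ C))

open Classical in
/-- The covering relation in bit form. [this work] -/
private theorem bits_adm {A B C : Set Ω} (hBAC : B ⊆ A ∪ C) (ω : Ω) :
    decide (ω ∈ B) = true → decide (ω ∈ A) = true ∨ decide (ω ∈ C) = true := by
  intro h
  rcases hBAC (of_decide_eq_true h) with h' | h'
  · exact Or.inl (decide_eq_true h')
  · exact Or.inr (decide_eq_true h')

open Classical in
/-- **The pattern map is monotone along implications**: if membership of `ω` in each event implies that of `ω'`,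
then `pat ω ≤ pat ω'`. [this work] -/
theorem pat_le_pat {A B C : Set Ω} (hBAC : B ⊆ A ∪ C) {ω ω' : Ω} (ha : ω ∈ A → ω' ∈ A) (hb : ω ∈ B → ω' ∈ B)
    (hc : ω ∈ C → ω' ∈ C) : pat A B C ω ≤ pat A B C ω' := by
  unfold pat
  exact ofBits_mono _ _ _ _ _ _ (bits_adm hBAC ω) (bits_adm hBAC ω')
    (fun h => decide_eq_true (ha (of_decide_eq_true h))) (fun h => decide_eq_true (hb (of_decide_eq_true h)))
    (fun h => decide_eq_true (hc (of_decide_eq_true h)))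

/-- For up-sets `A, B, C` of a preorder the pattern map is monotone. [this work] -/
theorem monotone_pat [Preorder Ω] {A B C : Set Ω} (hA : IsUpperSet A) (hB : IsUpperSet B) (hC : IsUpperSet C)
    (hBAC : B ⊆ A ∪ C) : Monotone (pat A B C) :=
  fun _ _ hle => pat_le_pat hBAC (fun h => hA hle h) (fun h => hB hle h) (fun h => hC hle h)

/-- For down-sets `A, B, C` of a preorder the pattern map is monotone on the ORDER DUAL. [this work] -/
theorem monotone_pat_toDual [Preorder Ω] {A B C : Set Ω} (hA : IsLowerSet A) (hB : IsLowerSet B) (hC : IsLowerSet C)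
    (hBAC : B ⊆ A ∪ C) : Monotone (fun a : Ωᵒᵈ => pat A B C (OrderDual.ofDual a)) :=
  fun _ _ hle => pat_le_pat hBAC (fun h => hA hle h) (fun h => hB hle h) (fun h => hC hle h)

open Literature.Probability.Percolation.DecisionTree (ind ind_of_mem ind_of_not_mem ind_nonneg)

open Classical in
/-- Pull-back of `U_A` along the pattern map: the event `A`. [this work] -/
theorem setInd_UA_comp_pat {A B C : Set Ω} (hBAC : B ⊆ A ∪ C) : setInd UA ∘ pat A B C = ind A := by
  funext ω
  simp only [Function.comp, setInd_apply, pat, ofBits_mem_UA _ _ _ (bits_adm hBAC ω), decide_eq_true_eq]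
  by_cases h : ω ∈ A
  · rw [if_pos h, ind_of_mem h]
  · rw [if_neg h, ind_of_not_mem h]

open Classical in
/-- Pull-back of `U_B` along the pattern map: the event `B`. [this work] -/
theorem setInd_UB_comp_pat {A B C : Set Ω} (hBAC : B ⊆ A ∪ C) : setInd UB ∘ pat A B C = ind B := by
  funext ω
  simp only [Function.comp, setInd_apply, pat, ofBits_mem_UB _ _ _ (bits_adm hBAC ω), decide_eq_true_eq]
  by_cases h : ω ∈ B
  · rw [if_pos h, ind_of_mem h]
  · rw [if_neg h, ind_of_not_mem h]

open Classical in
/-- Pull-back of `U_C` along the pattern map: the event `C`. [this work] -/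
theorem setInd_UC_comp_pat {A B C : Set Ω} (hBAC : B ⊆ A ∪ C) : setInd UC ∘ pat A B C = ind C := by
  funext ω
  simp only [Function.comp, setInd_apply, pat, ofBits_mem_UC _ _ _ (bits_adm hBAC ω), decide_eq_true_eq]
  by_cases h : ω ∈ C
  · rw [if_pos h, ind_of_mem h]
  · rw [if_neg h, ind_of_not_mem h]

end Pattern

/-! ## Part 3.  Transfer: product measures on `Set ι` (Kahn's setting; bond percolation = `ι = Sym2 V`) -/

section Product

open MeasureTheory
open Literature.Probability.LatticeModels (prodBernoulli sahiE3)
open Literature.Probability.Percolation.DecisionTree (ind)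

variable {ι : Type*} [Fintype ι]

/-- The pattern weight is a probability weight: nonnegative. [this work] -/
theorem pushWeight_pat_nonneg (p : ι → unitInterval) (A B C : Set (Set ι)) (x : P7) :
    0 ≤ pushWeight (bernoulliWeight p) (pat A B C) x :=
  pushWeight_nonneg (isFKGMeasure_bernoulliWeight p).nonneg _ x

/-- The pattern weight is a probability weight: total mass one. [this work] -/
theorem sum_pushWeight_pat (p : ι → unitInterval) (A B C : Set (Set ι)) :
    ∑ x, pushWeight (bernoulliWeight p) (pat A B C) x = 1 := by
  rw [sum_pushWeight, sum_bernoulliWeight]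

/-- **The cubic of the pattern weight is `E₃(A,B,C)`.** [this work] -/
theorem pat_cubic_eq (p : ι → unitInterval) {A B C : Set (Set ι)} (hBAC : B ⊆ A ∪ C) :
    sahiE (pushWeight (bernoulliWeight p) (pat A B C)) 3 ![setInd UA, setInd UB, setInd UC] =
      sahiE3 (prodBernoulli p) A B C := by
  rw [sahiE_pushWeight]
  have e : (fun i => (![setInd UA, setInd UB, setInd UC] : Fin 3 → P7 → ℝ) i ∘ pat A B C) = ![ind A, ind B, ind C] := by
    funext i
    fin_cases i
    · exact setInd_UA_comp_pat hBAC
    · exact setInd_UB_comp_pat hBAC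
    · exact setInd_UC_comp_pat hBAC
  rw [e, sahiE_three_ind]

/-- Order `2` of the pattern weight for three INCREASING events (Harris, transported along the monotone pattern map).
[this work] -/
theorem sahiPositive_two_pat_of_isUpperSet (p : ι → unitInterval) {A B C : Set (Set ι)} (hA : IsUpperSet A)
    (hB : IsUpperSet B) (hC : IsUpperSet C) (hBAC : B ⊆ A ∪ C) :
    SahiPositive (pushWeight (bernoulliWeight p) (pat A B C)) 2 :=
  SahiPositive.of_pushWeight (sahiPositive_two (isFKGMeasure_bernoulliWeight p)) (monotone_pat hA hB hC hBAC)

/-- Order `2` of the pattern weight for three DECREASING events (Harris on the order dual, transported). [this work] -/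
theorem sahiPositive_two_pat_of_isLowerSet (p : ι → unitInterval) {A B C : Set (Set ι)} (hA : IsLowerSet A)
    (hB : IsLowerSet B) (hC : IsLowerSet C) (hBAC : B ⊆ A ∪ C) :
    SahiPositive (pushWeight (bernoulliWeight p) (pat A B C)) 2 := by
  have h := SahiPositive.of_pushWeight (sahiPositive_two (isFKGMeasure_bernoulliWeightDual p))
    (monotone_pat_toDual hA hB hC hBAC)
  exact h

/-- **Three increasing events with `B ⊆ A ∪ C`: all orders ⟺ the one cubic.**  For every product measure on `Set ι`:
`(∀ n, SahiPositive (pattern weight) n) ↔ 0 ≤ sahiE3 (prodBernoulli p) A B C`. [this work] -/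
theorem sahiPositive_pat_iff_of_isUpperSet (p : ι → unitInterval) {A B C : Set (Set ι)} (hA : IsUpperSet A)
    (hB : IsUpperSet B) (hC : IsUpperSet C) (hBAC : B ⊆ A ∪ C) :
    (∀ n, SahiPositive (pushWeight (bernoulliWeight p) (pat A B C)) n) ↔ 0 ≤ sahiE3 (prodBernoulli p) A B C := by
  rw [sahiPositive_iff_two_and_cubic (pushWeight_pat_nonneg p A B C) (sum_pushWeight_pat p A B C), pat_cubic_eq p hBAC]
  exact ⟨fun h => h.2, fun h => ⟨sahiPositive_two_pat_of_isUpperSet p hA hB hC hBAC, h⟩⟩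

/-- **Three decreasing events with `B ⊆ A ∪ C`: all orders ⟺ the one cubic.**  For every product measure on `Set ι`:
`(∀ n, SahiPositive (pattern weight) n) ↔ 0 ≤ sahiE3 (prodBernoulli p) A B C`. [this work] -/
theorem sahiPositive_pat_iff_of_isLowerSet (p : ι → unitInterval) {A B C : Set (Set ι)} (hA : IsLowerSet A)
    (hB : IsLowerSet B) (hC : IsLowerSet C) (hBAC : B ⊆ A ∪ C) :
    (∀ n, SahiPositive (pushWeight (bernoulliWeight p) (pat A B C)) n) ↔ 0 ≤ sahiE3 (prodBernoulli p) A B C := by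
  rw [sahiPositive_iff_two_and_cubic (pushWeight_pat_nonneg p A B C) (sum_pushWeight_pat p A B C), pat_cubic_eq p hBAC]
  exact ⟨fun h => h.2, fun h => ⟨sahiPositive_two_pat_of_isLowerSet p hA hB hC hBAC, h⟩⟩

/-- **All orders from one cubic, decreasing events.**  If `A, B, C ⊆ Set ι` are decreasing, `B ⊆ A ∪ C`, and
`E₃(A,B,C) ≥ 0` under `prodBernoulli p`, then `E_n(f₀ ∘ pat, …, f_{n−1} ∘ pat) ≥ 0` for every `n` and all nonnegative
`f_i : P7 → ℝ` monotone on `P7` (nonnegative pattern-measurable functions, decreasing in the configuration). [this work] -/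
theorem sahiE_pattern_nonneg_of_isLowerSet (p : ι → unitInterval) {A B C : Set (Set ι)} (hA : IsLowerSet A)
    (hB : IsLowerSet B) (hC : IsLowerSet C) (hBAC : B ⊆ A ∪ C) (h3 : 0 ≤ sahiE3 (prodBernoulli p) A B C) {n : ℕ}
    (f : Fin n → P7 → ℝ) (hf0 : ∀ i x, 0 ≤ f i x) (hmono : ∀ i, Monotone (f i)) :
    0 ≤ sahiE (bernoulliWeight p) n fun i => f i ∘ pat A B C := by
  rw [← sahiE_pushWeight]
  exact (sahiPositive_pat_iff_of_isLowerSet p hA hB hC hBAC).2 h3 n f hf0 hmono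

/-- **All orders from one cubic, increasing events.**  Same with `A, B, C` increasing (pattern-measurable functions
increasing in the configuration). [this work] -/
theorem sahiE_pattern_nonneg_of_isUpperSet (p : ι → unitInterval) {A B C : Set (Set ι)} (hA : IsUpperSet A)
    (hB : IsUpperSet B) (hC : IsUpperSet C) (hBAC : B ⊆ A ∪ C) (h3 : 0 ≤ sahiE3 (prodBernoulli p) A B C) {n : ℕ}
    (f : Fin n → P7 → ℝ) (hf0 : ∀ i x, 0 ≤ f i x) (hmono : ∀ i, Monotone (f i)) :
    0 ≤ sahiE (bernoulliWeight p) n fun i => f i ∘ pat A B C := by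
  rw [← sahiE_pushWeight]
  exact (sahiPositive_pat_iff_of_isUpperSet p hA hB hC hBAC).2 h3 n f hf0 hmono

end Product

end P7
end Summit.CriticalPhenomena.PercolationContinuityZ3.Theorems.SahiDeltaSystem
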